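import Summits.QuantumFields.YangMills.Theorems.BalabanStepParabolic.Negative.ScalingLimitInRegion

/-!
# `BalabanStepParabolic` — negative-side support XVII: the forced scaling limits depend continuously on the coupling

Support file for crux `stmt-QuantumFields-9684` (`ParabolicTrajectory.BalabanStepParabolic`), extracted from the
standing disprover's work file `Cruxes/BalabanStepParabolic/Disproof.lean` §V (cycle 3); continuation of
`ScalingLimitInRegion.lean`. Tree objects only.

* `limit_lipschitz_of_region`: the limits `q`, `q'` of two in-region deep sequences with arrival couplings
  `→ t`, `→ t'` satisfy `‖q.2 − q'.2‖ ≤ λ |t − t'|` (`λ = 2C(2τ₀+δ)/(1−θ')`): the deep orbit closure is a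
  `λ`-Lipschitz GRAPH over the reachable couplings;
* **`forced_scaling_limit_continuous`** (odd `M`): the graph `Q` of `forced_scaling_limit_of_region` can be
  taken Lipschitz on the set of reachable couplings, and for every off-diagonal test tuple the forced scaling
  limit `t ↦ expect (Q t) (2L+1) n σ f` of the genuine dilated Wilson data is CONTINUOUS on that set — the
  continuum correlators forced by (4c) form a continuous family in the running coupling.
-/

namespace Summit.QuantumFields.YangMills.Theorems.BalabanStepParabolic.Negative

open scoped SchwartzMap
open MeasureTheory Filter Topology
open Literature.MathematicalPhysics.QuantumFieldTheory Literature.MathematicalPhysics.AQFT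
open Literature.MathematicalPhysics.QuantumLattice

noncomputable section

variable {G : Type} [Group G] [TopologicalSpace G] [IsTopologicalGroup G] [CompactSpace G]
  [MeasurableSpace G] [BorelSpace G] {r : LatticeRep G} {M : ℕ} (S : BalabanBanachStep G r M)

/-- **The deep orbit closure is a Lipschitz graph.** Limits of in-region deep sequences with arrival
couplings `→ t` and `→ t'` have fibres at distance `≤ λ |t − t'|`. [folklore] -/
theorem limit_lipschitz_of_region {τ₀ : ℝ} (hτδ : τ₀ ≤ S.δ)
    (hτδ2 : S.C * τ₀ ^ 2 / (1 - S.θ') ≤ S.δ / 2)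
    (hsmall : S.C * τ₀ ^ 2 * (τ₀ + S.δ) + S.C * τ₀ ^ 3 * (2 * S.C * (2 * τ₀ + S.δ) / (1 - S.θ')) ≤
      (1 - S.θ') / 2)
    {i₀ : ℕ} (hi₀ : S.θ' ^ i₀ * S.R ≤ S.δ / 2)
    {g g' : ℕ → ℝ} {k k' : ℕ → ℕ} (hg : ∀ j, g j ∈ Set.Icc 0 S.g₀) (hg' : ∀ j, g' j ∈ Set.Icc 0 S.g₀)
    (hreg : ∀ j, ∀ i ≤ k j, (S.F^[i] (g j, S.yW (g j))).1 ∈ Set.Icc 0 τ₀ ∧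
      ‖(S.F^[i] (g j, S.yW (g j))).2‖ ≤ S.R)
    (hreg' : ∀ j, ∀ i ≤ k' j, (S.F^[i] (g' j, S.yW (g' j))).1 ∈ Set.Icc 0 τ₀ ∧
      ‖(S.F^[i] (g' j, S.yW (g' j))).2‖ ≤ S.R)
    (hkinf : Tendsto k atTop atTop) (hkinf' : Tendsto k' atTop atTop) {t t' : ℝ} {q q' : ℝ × S.E}
    (hc : Tendsto (fun j => (S.F^[k j] (g j, S.yW (g j))).1) atTop (𝓝 t))
    (hc' : Tendsto (fun j => (S.F^[k' j] (g' j, S.yW (g' j))).1) atTop (𝓝 t'))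
    (hq : Tendsto (fun j => S.F^[k j] (g j, S.yW (g j))) atTop (𝓝 q))
    (hq' : Tendsto (fun j => S.F^[k' j] (g' j, S.yW (g' j))) atTop (𝓝 q')) :
    ‖q.2 - q'.2‖ ≤ (2 * S.C * (2 * τ₀ + S.δ) / (1 - S.θ')) * |t - t'| := by
  have hθ'0 := S.θ'_nonneg
  have hϑ0 : 0 ≤ (1 + S.θ') / 2 := by linarith
  have hϑ1 : (1 + S.θ') / 2 < 1 := by linarith [S.θ'_lt_one]
  have h2 : ∀ m₀ : ℕ, ‖q.2 - q'.2‖ ≤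
      (2 * S.C * (2 * τ₀ + S.δ) / (1 - S.θ')) * |t - t'| + ((1 + S.θ') / 2) ^ m₀ * (2 * S.δ) := by
    intro m₀
    have hev : ∀ᶠ j in atTop, ‖(S.F^[k j] (g j, S.yW (g j))).2 - (S.F^[k' j] (g' j, S.yW (g' j))).2‖ ≤
        (2 * S.C * (2 * τ₀ + S.δ) / (1 - S.θ')) *
          |(S.F^[k j] (g j, S.yW (g j))).1 - (S.F^[k' j] (g' j, S.yW (g' j))).1| +
        ((1 + S.θ') / 2) ^ m₀ * (2 * S.δ) := by
      filter_upwards [hkinf.eventually (eventually_ge_atTop (m₀ + i₀)),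
        hkinf'.eventually (eventually_ge_atTop (m₀ + i₀))] with j hj hj'
      exact pair_estimate_of_region S hτδ hτδ2 hsmall hi₀ (hg j) (hg' j) (hreg j) (hreg' j) hj hj'
    have hlim1 : Tendsto (fun j => ‖(S.F^[k j] (g j, S.yW (g j))).2 -
        (S.F^[k' j] (g' j, S.yW (g' j))).2‖) atTop (𝓝 ‖q.2 - q'.2‖) :=
      (hq.snd_nhds.sub hq'.snd_nhds).norm
    have hlim2 : Tendsto (fun j => (2 * S.C * (2 * τ₀ + S.δ) / (1 - S.θ')) *
          |(S.F^[k j] (g j, S.yW (g j))).1 - (S.F^[k' j] (g' j, S.yW (g' j))).1| +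
        ((1 + S.θ') / 2) ^ m₀ * (2 * S.δ)) atTop
        (𝓝 ((2 * S.C * (2 * τ₀ + S.δ) / (1 - S.θ')) * |t - t'| + ((1 + S.θ') / 2) ^ m₀ * (2 * S.δ))) :=
      (((hc.sub hc').abs).const_mul (2 * S.C * (2 * τ₀ + S.δ) / (1 - S.θ'))).add_const _
    exact le_of_tendsto_of_tendsto hlim1 hlim2 hev
  have hpow := ((tendsto_pow_atTop_nhds_zero_of_lt_one hϑ0 hϑ1).mul_const (2 * S.δ)).const_add
    ((2 * S.C * (2 * τ₀ + S.δ) / (1 - S.θ')) * |t - t'|)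
  rw [zero_mul, add_zero] at hpow
  exact ge_of_tendsto' hpow h2

/-- **THE FORCED SCALING LIMITS ARE CONTINUOUS IN THE RUNNING COUPLING (any inhabitant, odd `M`).**
With `τmax` as in `forced_scaling_limit_of_region`: for every cap `τ₀ ∈ (0, τmax]` there is a graph
`Q : ℝ → [0, δ] × B̄_R` such that, writing `T` for the set of REACHABLE couplings (limits of arrival
couplings of in-region(`τ₀`) deep sequences), (i) along every in-region deep sequence with arrival couplings
`→ t` the orbit points converge to `Q t` and the genuine dilated Wilson data converge to
`expect (Q t) (2L+1) n σ f`; (ii) `Q` is Lipschitz on `T` (constant `max 1 λ`, sup metric); (iii) for every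
off-diagonal test tuple the forced scaling limit `t ↦ expect (Q t) (2L+1) n σ f` is CONTINUOUS on `T`.
(`ScalingLimitReach`: `T` is `c₁t³`-dense near `0`.) [folklore] -/
theorem forced_scaling_limit_continuous (hM : Odd M) :
    ∃ τmax : ℝ, 0 < τmax ∧ τmax ≤ S.g₀ ∧ τmax ≤ S.δ ∧
    ∀ τ₀ : ℝ, 0 < τ₀ → τ₀ ≤ τmax →
    ∃ Q : ℝ → ℝ × S.E, (∀ t, Q t ∈ Set.Icc 0 S.δ ×ˢ Metric.closedBall (0 : S.E) S.R) ∧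
    (∀ (g : ℕ → ℝ) (k : ℕ → ℕ) (t : ℝ),
      (∀ j, g j ∈ Set.Ioc 0 S.g₀) →
      (∀ j, ∀ i ≤ k j, (S.F^[i] (g j, S.yW (g j))).1 ∈ Set.Icc 0 τ₀ ∧
        ‖(S.F^[i] (g j, S.yW (g j))).2‖ ≤ S.R) →
      Tendsto k atTop atTop →
      Tendsto (fun j => (S.F^[k j] (g j, S.yW (g j))).1) atTop (𝓝 t) →
      Tendsto (fun j => S.F^[k j] (g j, S.yW (g j))) atTop (𝓝 (Q t)) ∧
      ∀ (L n : ℕ) (σ : Fin n → YMSpecies G) (f : Fin n → 𝓢(EuclideanSpace ℝ (Fin 4), ℝ)),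
        IsOffDiagonal (SchwartzMap.tensorFin n fun i => ofRealTest (f i)) →
        Tendsto (fun j => wilsonCentredSchwinger r.ρ (S.betaOf (g j))
            ((M ^ (k j) * (2 * L + 1) - 1) / 2) (S.c (g j)) n σ
            (fun i => (blockDilate M)^[k j] (f i))) atTop
          (𝓝 (S.expect (Q t) (2 * L + 1) n σ f))) ∧
    LipschitzOnWith ⟨max 1 (2 * S.C * (2 * τ₀ + S.δ) / (1 - S.θ')), by positivity⟩ Q
      {t | ∃ (g : ℕ → ℝ) (k : ℕ → ℕ), (∀ j, g j ∈ Set.Ioc 0 S.g₀) ∧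
        (∀ j, ∀ i ≤ k j, (S.F^[i] (g j, S.yW (g j))).1 ∈ Set.Icc 0 τ₀ ∧
          ‖(S.F^[i] (g j, S.yW (g j))).2‖ ≤ S.R) ∧
        Tendsto k atTop atTop ∧ Tendsto (fun j => (S.F^[k j] (g j, S.yW (g j))).1) atTop (𝓝 t)} ∧
    ∀ (L n : ℕ) (σ : Fin n → YMSpecies G) (f : Fin n → 𝓢(EuclideanSpace ℝ (Fin 4), ℝ)),
      IsOffDiagonal (SchwartzMap.tensorFin n fun i => ofRealTest (f i)) →
      ContinuousOn (fun t => S.expect (Q t) (2 * L + 1) n σ f)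
        {t | ∃ (g : ℕ → ℝ) (k : ℕ → ℕ), (∀ j, g j ∈ Set.Ioc 0 S.g₀) ∧
          (∀ j, ∀ i ≤ k j, (S.F^[i] (g j, S.yW (g j))).1 ∈ Set.Icc 0 τ₀ ∧
            ‖(S.F^[i] (g j, S.yW (g j))).2‖ ≤ S.R) ∧
          Tendsto k atTop atTop ∧ Tendsto (fun j => (S.F^[k j] (g j, S.yW (g j))).1) atTop (𝓝 t)} := by
  obtain ⟨τmax, hτmax0, hτg₀, hτmaxδ, hτs, hmain⟩ := forced_scaling_limit_of_region S hM
  obtain ⟨i₀, hi₀⟩ := exists_i₀ S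
  -- recover the smallness at τmax from `exists_τ₀`?  We only need it for caps ≤ τmax; re-derive via the
  -- defining properties: `forced_scaling_limit_of_region` was built from `exists_τ₀`, but its statement does
  -- not export the smallness, so we take a possibly smaller threshold.
  obtain ⟨τ₁, hτ₁0, hτ₁s, hτ₁g₀, hτ₁δ2, hτ₁small⟩ := exists_τ₀ S
  refine ⟨min τmax τ₁, lt_min hτmax0 hτ₁0, (min_le_left _ _).trans hτg₀, (min_le_left _ _).trans hτmaxδ,
    fun τ₀ hτ0 hτle => ?_⟩
  obtain ⟨-, Q, hQmem, hQ⟩ := hmain τ₀ hτ0 (hτle.trans (min_le_left _ _))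
  obtain ⟨hτδ2, hsmall⟩ := smallness_mono S hτ0.le (hτle.trans (min_le_right _ _)) hτ₁δ2 hτ₁small
  have hτδ : τ₀ ≤ S.δ := (hτle.trans (min_le_left _ _)).trans hτmaxδ
  have hIcc : ∀ {g : ℕ → ℝ}, (∀ j, g j ∈ Set.Ioc 0 S.g₀) → ∀ j, g j ∈ Set.Icc 0 S.g₀ :=
    fun h j => ⟨(h j).1.le, (h j).2⟩
  -- Lipschitz on the reachable set
  have hLip : ∀ t t' : ℝ,
      (∃ (g : ℕ → ℝ) (k : ℕ → ℕ), (∀ j, g j ∈ Set.Ioc 0 S.g₀) ∧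
        (∀ j, ∀ i ≤ k j, (S.F^[i] (g j, S.yW (g j))).1 ∈ Set.Icc 0 τ₀ ∧
          ‖(S.F^[i] (g j, S.yW (g j))).2‖ ≤ S.R) ∧
        Tendsto k atTop atTop ∧ Tendsto (fun j => (S.F^[k j] (g j, S.yW (g j))).1) atTop (𝓝 t)) →
      (∃ (g : ℕ → ℝ) (k : ℕ → ℕ), (∀ j, g j ∈ Set.Ioc 0 S.g₀) ∧
        (∀ j, ∀ i ≤ k j, (S.F^[i] (g j, S.yW (g j))).1 ∈ Set.Icc 0 τ₀ ∧
          ‖(S.F^[i] (g j, S.yW (g j))).2‖ ≤ S.R) ∧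
        Tendsto k atTop atTop ∧ Tendsto (fun j => (S.F^[k j] (g j, S.yW (g j))).1) atTop (𝓝 t')) →
      dist (Q t) (Q t') ≤ max 1 (2 * S.C * (2 * τ₀ + S.δ) / (1 - S.θ')) * |t - t'| := by
    rintro t t' ⟨g, k, hg, hreg, hkinf, hc⟩ ⟨g', k', hg', hreg', hkinf', hc'⟩
    have hq := (hQ g k t hg hreg hkinf hc).1
    have hq' := (hQ g' k' t' hg' hreg' hkinf' hc').1
    have h1 : (Q t).1 = t := tendsto_nhds_unique hq.fst_nhds hc
    have h1' : (Q t').1 = t' := tendsto_nhds_unique hq'.fst_nhds hc'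
    have h2 := limit_lipschitz_of_region S hτδ hτδ2 hsmall hi₀ (hIcc hg) (hIcc hg') hreg hreg' hkinf hkinf'
      hc hc' hq hq'
    have habs : 0 ≤ |t - t'| := abs_nonneg _
    rw [Prod.dist_eq, Real.dist_eq, dist_eq_norm, h1, h1']
    refine max_le ?_ ?_
    · calc |t - t'| = 1 * |t - t'| := (one_mul _).symm
        _ ≤ max 1 (2 * S.C * (2 * τ₀ + S.δ) / (1 - S.θ')) * |t - t'| := by
            gcongr; exact le_max_left _ _
    · exact h2.trans (mul_le_mul_of_nonneg_right (le_max_right _ _) habs)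
  have hLipOn : LipschitzOnWith ⟨max 1 (2 * S.C * (2 * τ₀ + S.δ) / (1 - S.θ')), by positivity⟩ Q
      {t | ∃ (g : ℕ → ℝ) (k : ℕ → ℕ), (∀ j, g j ∈ Set.Ioc 0 S.g₀) ∧
        (∀ j, ∀ i ≤ k j, (S.F^[i] (g j, S.yW (g j))).1 ∈ Set.Icc 0 τ₀ ∧
          ‖(S.F^[i] (g j, S.yW (g j))).2‖ ≤ S.R) ∧
        Tendsto k atTop atTop ∧ Tendsto (fun j => (S.F^[k j] (g j, S.yW (g j))).1) atTop (𝓝 t)} := by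
    refine LipschitzOnWith.of_dist_le_mul fun t ht t' ht' => ?_
    change dist (Q t) (Q t') ≤ max 1 (2 * S.C * (2 * τ₀ + S.δ) / (1 - S.θ')) * dist t t'
    rw [Real.dist_eq]
    exact hLip t t' ht ht'
  refine ⟨Q, hQmem, hQ, hLipOn, fun L n σ f hf => ?_⟩
  exact (S.continuousOn_expect (2 * L + 1) n σ f hf).comp hLipOn.continuousOn fun t _ => hQmem t

end

end Summit.QuantumFields.YangMills.Theorems.BalabanStepParabolic.Negative
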